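import Mathlib
import Literature.RepresentationTheory.FiniteGroups.PlancherelFewRowsTail
import HarnessLib

/-!
# `SnSubsetDichotomy.NoThresholdSubsetTriple`, line `klr-graded-polynomial-method`:
# stub `stub_durfeeShape` — general lemmas (layers over a family of windows, slot and arcsine
# integrals left of the origin)

Auxiliary lemmas for the per-shape Durfee-square tail of the Plancherel measure
(`stub_durfeeShape`, next file), in the set-up of the tree's Vershik–Kerov files
(`VershikKerovLimitShape`, `PlancherelFewRowsTail`):

* `mul_sq_layers_le_integral_sq_div_sq` — a lower bound for the `H^{1/2}` layer integral
  `∫₀^{s₂} s⁻² D(s) ds`, `D(s) = ∫ (∫_x^{x+s} η)² dx`, from a family of windows: if for every scale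
  `s ∈ (s₁, s₂)` the squared window integral is `≥ m²` for all `x` in an interval of length `w`, then
  `w m² (s₂ - s₁) / s₂² ≤ ∫₀^{s₂} s⁻² D(s) ds` (the tree's `mul_mul_sq_le_integral_sq_div_sq` is the
  pointwise version);
* `integral_arcsin_neg_one_zero` — `∫_{-1}^{0} arcsin = 1 - π/2`;
* `integral_arcsineCDF_neg_zero` — `∫_{-R}^{0} F_a = a/π` for `R ≥ a > 0` (`F_a` the arcsine
  distribution function of `[-a, a]`);
* `integral_ascSlot_neg_zero` — `∫_{-R}^{0} p = #{j < R : (j, j) ∈ Y}`: the ascending unit slots of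
  the rotated boundary of a Young diagram `Y` left of the origin are the `u_j = j - λ'_j < 0`, i.e. the
  diagonal cells of `Y` (the side of its Durfee square).

All statements are elementary; theorems only, no definitions, no named facts.
-/

-- `Summit.<Summit>.<Problem>`: summit and problem coincide for this single-conjunct summit.
set_option linter.dupNamespace false

noncomputable section

open MeasureTheory Set Filter intervalIntegral
open scoped Real Topology Interval BigOperators

namespace Summit.MatrixMultiplication.MatrixMultiplication.Theorems

namespace DurfeeShape

open Literature.RepresentationTheory.FiniteGroups
open Literature.RepresentationTheory.FiniteGroups.VershikKerov
open Literature.Analysis.Potential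

/-! ### Layers over a family of windows -/

/-- **Layers over a family of windows.** Let `η` be bounded, measurable, vanishing off `[-L, L]`.
If `0 ≤ s₁ < s₂`, `w ≥ 0`, and for every `s ∈ (s₁, s₂)` and every `x ∈ [u(s), u(s) + w]` the window
integral satisfies `m² ≤ (∫_x^{x+s} η)²`, then
`w · m² · (s₂ - s₁) / s₂² ≤ ∫₀^{s₂} s⁻² (∫ (∫_x^{x+s} η)² dx) ds`
(restrict `x` to `[u(s), u(s) + w]` for `s ∈ (s₁, s₂)`, where `D(s) ≥ w m²` and `s⁻² ≥ s₂⁻²`, and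
drop `(0, s₁)` where the integrand is nonnegative). [folklore] -/
theorem mul_sq_layers_le_integral_sq_div_sq : ∀ (η : ℝ → ℝ) (C L : ℝ), Measurable η → (∀ x, |η x| ≤ C) → (∀ x ∉ Set.Icc (-L) L, η x = 0) → 0 ≤ L → ∀ (s₁ s₂ w m : ℝ) (u : ℝ → ℝ), 0 ≤ s₁ → s₁ < s₂ → 0 ≤ w → (∀ s ∈ Set.Ioo s₁ s₂, ∀ x ∈ Set.Icc (u s) (u s + w), m ^ 2 ≤ (∫ t in x..x + s, η t) ^ 2) → w * m ^ 2 * (s₂ - s₁) / s₂ ^ 2 ≤ ∫ s in (0:ℝ)..s₂, (∫ x, (∫ t in x..x + s, η t) ^ 2) / s ^ 2 := by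
  intro η C L hηm hηC hη0 hL s₁ s₂ w m u hs₁ hs₁₂ hw hle
  have hs₂ : 0 < s₂ := lt_of_le_of_lt hs₁ hs₁₂
  -- pointwise in `s ∈ (s₁, s₂)`
  have hpt : ∀ s ∈ Ioo s₁ s₂,
      w * m ^ 2 / s₂ ^ 2 ≤ (∫ x, (∫ t in x..x + s, η t) ^ 2) / s ^ 2 := by
    intro s hs
    have hs0 : 0 < s := lt_of_le_of_lt hs₁ hs.1
    set f : ℝ → ℝ := fun x => (∫ t in x..x + s, η t) ^ 2 with hf
    have hfint : Integrable f := integrable_sq_windowIntegral hηm hηC hη0 hs0.le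
    set I : Set ℝ := Icc (u s) (u s + w) with hI
    have h1 : ∫ x in I, f x ≤ ∫ x, f x :=
      setIntegral_le_integral hfint (Eventually.of_forall fun x => sq_nonneg _)
    have hvol : volume.real I = w := by
      simp only [hI]
      rw [Real.volume_real_Icc_of_le (by linarith)]
      ring
    have h3 : m ^ 2 * w ≤ ∫ x in I, f x := by
      calc m ^ 2 * w = ∫ _ in I, m ^ 2 := by
            rw [setIntegral_const, hvol, smul_eq_mul, mul_comm]
        _ ≤ ∫ x in I, f x :=
            setIntegral_mono_on (integrableOn_const (by simp [hI])) hfint.integrableOn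
              measurableSet_Icc fun x hx => hle s hs x hx
    have h5 : w * m ^ 2 / s₂ ^ 2 ≤ w * m ^ 2 / s ^ 2 :=
      div_le_div_of_nonneg_left (by positivity) (pow_pos hs0 2)
        (pow_le_pow_left₀ hs0.le hs.2.le 2)
    refine h5.trans ?_
    rw [div_le_div_iff_of_pos_right (pow_pos hs0 2)]
    linarith
  -- interval integrability on `[0, s₂]`
  have hR : IntervalIntegrable (fun s => (∫ x, (∫ t in x..x + s, η t) ^ 2) / s ^ 2)
      volume 0 s₂ := by
    have h := intervalIntegrable_sq_div_sq hηm hηC hη0 hL (R := max (2 * L) s₂)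
      (lt_of_lt_of_le hs₂ (le_max_right _ _)) (le_max_left _ _)
    exact h.mono_set (by
      rw [uIcc_of_le hs₂.le, uIcc_of_le (hs₂.le.trans (le_max_right _ _))]
      exact Icc_subset_Icc le_rfl (le_max_right _ _))
  have hnonneg : ∀ s, 0 ≤ (∫ x, (∫ t in x..x + s, η t) ^ 2) / s ^ 2 := fun s =>
    div_nonneg (integral_nonneg fun x => sq_nonneg _) (sq_nonneg _)
  have hR1 : IntervalIntegrable (fun s => (∫ x, (∫ t in x..x + s, η t) ^ 2) / s ^ 2)
      volume 0 s₁ :=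
    hR.mono_set (by
      rw [uIcc_of_le hs₁, uIcc_of_le hs₂.le]
      exact Icc_subset_Icc le_rfl hs₁₂.le)
  have hR2 : IntervalIntegrable (fun s => (∫ x, (∫ t in x..x + s, η t) ^ 2) / s ^ 2)
      volume s₁ s₂ :=
    hR.mono_set (by
      rw [uIcc_of_le hs₁₂.le, uIcc_of_le hs₂.le]
      exact Icc_subset_Icc hs₁ le_rfl)
  rw [← integral_add_adjacent_intervals hR1 hR2]
  have hI1 : 0 ≤ ∫ s in (0:ℝ)..s₁, (∫ x, (∫ t in x..x + s, η t) ^ 2) / s ^ 2 :=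
    intervalIntegral.integral_nonneg hs₁ fun s _ => hnonneg s
  have hlhs : ∫ _ in s₁..s₂, w * m ^ 2 / s₂ ^ 2 = w * m ^ 2 * (s₂ - s₁) / s₂ ^ 2 := by
    rw [intervalIntegral.integral_const, smul_eq_mul]
    ring
  have hI2 : w * m ^ 2 * (s₂ - s₁) / s₂ ^ 2 ≤
      ∫ s in s₁..s₂, (∫ x, (∫ t in x..x + s, η t) ^ 2) / s ^ 2 := by
    rw [← hlhs]
    exact integral_mono_on_of_le_Ioo hs₁₂.le intervalIntegrable_const hR2 hpt
  linarith

/-! ### `∫_{-1}^{0} arcsin` and `∫_{-R}^{0} F_a` -/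

/-- **`∫_{-1}^{0} arcsin u du = 1 - π/2`** (antiderivative `u arcsin u + √(1 - u²)`). [folklore] -/
theorem integral_arcsin_neg_one_zero : ∫ u in (-1:ℝ)..0, Real.arcsin u = 1 - π / 2 := by
  set G : ℝ → ℝ := fun u => u * Real.arcsin u + Real.sqrt (1 - u ^ 2) with hG
  have hderiv : ∀ u ∈ Ioo (-1:ℝ) 0, HasDerivAt G (Real.arcsin u) u := by
    intro u hu
    have hu1 : u ≠ -1 := hu.1.ne'
    have hu2 : u ≠ 1 := ne_of_lt (by linarith [hu.2])
    have hpos : 0 < 1 - u ^ 2 := by nlinarith [hu.1, hu.2]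
    have hsq : Real.sqrt (1 - u ^ 2) ≠ 0 := (Real.sqrt_pos.mpr hpos).ne'
    have hA : HasDerivAt Real.arcsin (1 / Real.sqrt (1 - u ^ 2)) u :=
      Real.hasDerivAt_arcsin hu1 hu2
    have hQ : HasDerivAt (fun u : ℝ => 1 - u ^ 2) (-(2 * u)) u := by
      simpa using (hasDerivAt_pow 2 u).const_sub 1
    have hS : HasDerivAt (fun u : ℝ => Real.sqrt (1 - u ^ 2))
        (-(2 * u) / (2 * Real.sqrt (1 - u ^ 2))) u := hQ.sqrt hpos.ne'
    have h := ((hasDerivAt_id u).mul hA).add hS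
    refine h.congr_deriv ?_
    simp only [id_eq]
    field_simp
    ring
  have hcont : ContinuousOn G (Icc (-1) 0) := by
    have : Continuous G := by rw [hG]; fun_prop
    exact this.continuousOn
  rw [intervalIntegral.integral_eq_sub_of_hasDerivAt_of_le (by norm_num) hcont hderiv
    (Real.continuous_arcsin.intervalIntegrable _ _)]
  simp only [hG, Real.arcsin_zero, Real.arcsin_neg, Real.arcsin_one]
  norm_num

/-- `∫_{-a}^{0} F_a = a/π` for the arcsine distribution function `F_a(x) = ½ + arcsin(x/a)/π` of
`[-a, a]`, `a > 0` (substitute `x = a u`, `∫_{-1}^{0} (½ + arcsin u/π) du = 1/π`). [folklore] -/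
theorem integral_arcsineCDF_neg_self_zero {a : ℝ} (ha : 0 < a) :
    ∫ x in (-a)..0, arcsineCDF a x = a / π := by
  have hπ := Real.pi_pos
  have hga : ∀ x, arcsineCDF a x = (fun u => 1 / 2 + Real.arcsin u / π) (x / a) := by
    intro x; simp only [arcsineCDF]
  rw [show (∫ x in (-a)..0, arcsineCDF a x) =
      ∫ x in (-a)..0, (fun u => 1 / 2 + Real.arcsin u / π) (x / a) from
    integral_congr fun x _ => hga x]
  rw [intervalIntegral.integral_comp_div (fun u => 1 / 2 + Real.arcsin u / π) ha.ne', neg_div,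
    div_self ha.ne', zero_div, smul_eq_mul]
  rw [intervalIntegral.integral_add intervalIntegrable_const
      ((Real.continuous_arcsin.div_const π).intervalIntegrable _ _),
    intervalIntegral.integral_const, intervalIntegral.integral_div, integral_arcsin_neg_one_zero,
    smul_eq_mul]
  field_simp
  ring

/-- `∫_{-R}^{0} F_a = a/π` for `R ≥ a > 0` (`F_a = 0` on `(-∞, -a]`). [folklore] -/
theorem integral_arcsineCDF_neg_zero {a R : ℝ} (ha : 0 < a) (haR : a ≤ R) :
    ∫ x in (-R)..0, arcsineCDF a x = a / π := by
  have hc := continuous_arcsineCDF a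
  rw [← integral_add_adjacent_intervals (b := -a) (hc.intervalIntegrable _ _)
    (hc.intervalIntegrable _ _), integral_arcsineCDF_neg_self_zero ha]
  have h0 : ∫ x in (-R)..(-a), arcsineCDF a x = ∫ _ in (-R)..(-a), (0:ℝ) := by
    refine integral_congr fun x hx => ?_
    rw [uIcc_of_le (by linarith)] at hx
    exact arcsineCDF_of_le_neg ha hx.2
  rw [h0, intervalIntegral.integral_zero, zero_add]

/-! ### The ascending slots left of the origin are the diagonal cells -/

/-- `∫_m^{m+1} p = p(m)` for an integer `m`: the ascending-slot indicator is constant on unit slots.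
[folklore] -/
theorem integral_ascSlot_unit (Y : YoungDiagram) (R : ℕ) (m : ℤ) :
    ∫ x in (m:ℝ)..(m:ℝ) + 1, ascSlot Y R x = ascSlot Y R m := by
  rw [integral_of_le (by linarith), integral_Ioc_eq_integral_Ioo]
  have h : ∀ x ∈ Ioo (m:ℝ) (m + 1), ascSlot Y R x = ascSlot Y R m := by
    intro x hx
    rw [ascSlot_eq_floor R x]
    have : ⌊x⌋ = m := Int.floor_eq_iff.mpr ⟨hx.1.le, hx.2⟩
    rw [this]
  rw [setIntegral_congr_fun measurableSet_Ioo h, setIntegral_const,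
    Real.volume_real_Ioo_of_le (by linarith), smul_eq_mul]
  ring

/-- **`∫_{-R}^{0} p = #{j < R : (j, j) ∈ Y}`** for `R ≥ λ'_0`: the ascending unit slots of the rotated
boundary in `[-R, 0)` are the slots `[u_j, u_j + 1)` with `u_j = j - λ'_j < 0`, `j < R`, i.e. with
`j < λ'_j`, i.e. `(j, j) ∈ Y` — the side of the Durfee square of `Y` (counted among the first `R`
columns). [folklore] -/
theorem integral_ascSlot_neg_zero {Y : YoungDiagram} {R : ℕ} (hR₂ : Y.colLen 0 ≤ R) :
    ∫ x in (-(R:ℝ))..0, ascSlot Y R x =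
      (((Finset.range R).filter fun j : ℕ => (j, j) ∈ Y).card : ℝ) := by
  -- split `[-R, 0]` at the integers
  have hsum := sum_integral_adjacent_intervals (μ := volume) (f := ascSlot Y R)
    (a := fun k : ℕ => -(R:ℝ) + k) (n := R) (fun k _ => intervalIntegrable_ascSlot R _ _)
  simp only [Nat.cast_zero, add_zero, neg_add_cancel] at hsum
  rw [← hsum]
  -- each unit integral is the slot value `1{-R + k ∈ {u_j : j < R}}`
  have hunit : ∀ k ∈ Finset.range R,
      ∫ x in (-(R:ℝ) + k)..(-(R:ℝ) + ((k + 1 : ℕ) : ℝ)), ascSlot Y R x =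
        if (-(R:ℤ) + k) ∈ (Finset.range R).image (upPos Y) then (1:ℝ) else 0 := by
    intro k hk
    have hk' := Finset.mem_range.mp hk
    have h1 : (((-(R:ℤ) + k : ℤ)) : ℝ) = -(R:ℝ) + k := by push_cast; ring
    have h2 : (-(R:ℝ) + ((k + 1 : ℕ) : ℝ)) = ((-(R:ℤ) + k : ℤ) : ℝ) + 1 := by push_cast; ring
    rw [h2, ← h1, integral_ascSlot_unit, ascSlot, Int.floor_intCast]
    have h3 : ¬ (R : ℤ) ≤ -(R:ℤ) + k := by omega
    simp only [h3, or_false]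
  rw [Finset.sum_congr rfl hunit]
  -- count: swap the sums
  simp_rw [ite_mem_image_eq_sum _ (upPos_strictMono Y).injective]
  rw [Finset.sum_comm]
  have hinner : ∀ j ∈ Finset.range R,
      (∑ k ∈ Finset.range R, if (-(R:ℤ) + k) = upPos Y j then (1:ℝ) else 0) =
        if (j, j) ∈ Y then 1 else 0 := by
    intro j _
    by_cases hjY : (j, j) ∈ Y
    · rw [if_pos hjY]
      have hlt : upPos Y j < 0 := by
        have := YoungDiagram.mem_iff_lt_colLen.mp hjY
        simp only [upPos]; omega
      have hge : -(R:ℤ) ≤ upPos Y j := le_trans (by omega) (neg_le_upPos Y j)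
      rw [Finset.sum_eq_single_of_mem (upPos Y j + R).toNat]
      · rw [if_pos]; omega
      · rw [Finset.mem_range]; omega
      · intro k _ hk; rw [if_neg]; omega
    · rw [if_neg hjY]
      have hge : 0 ≤ upPos Y j := by
        have : ¬ j < Y.colLen j := fun h => hjY (YoungDiagram.mem_iff_lt_colLen.mpr h)
        simp only [upPos]; omega
      exact Finset.sum_eq_zero fun k hk => if_neg (by have := Finset.mem_range.mp hk; omega)
  rw [Finset.sum_congr rfl hinner, Finset.sum_boole]

/-- The diagonal cells `(j, j) ∈ Y` have `j < λ_0`; so they may be counted among `j < R` for any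
`R ≥ λ_0`. [folklore] -/
theorem filter_diag_eq_of_rowLen_le {Y : YoungDiagram} {R M : ℕ} (hR : Y.rowLen 0 ≤ R)
    (hM : Y.rowLen 0 ≤ M) :
    ((Finset.range R).filter fun j : ℕ => (j, j) ∈ Y) =
      (Finset.range M).filter fun j : ℕ => (j, j) ∈ Y := by
  have key : ∀ j : ℕ, (j, j) ∈ Y → j < Y.rowLen 0 := fun j hj =>
    YoungDiagram.mem_iff_lt_rowLen.mp (Y.up_left_mem (Nat.zero_le j) le_rfl hj)
  ext j
  simp only [Finset.mem_filter, Finset.mem_range]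
  constructor
  · rintro ⟨-, hj⟩; exact ⟨lt_of_lt_of_le (key j hj) hM, hj⟩
  · rintro ⟨-, hj⟩; exact ⟨lt_of_lt_of_le (key j hj) hR, hj⟩

end DurfeeShape

end Summit.MatrixMultiplication.MatrixMultiplication.Theorems

end
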